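import Literature.AlgebraicGeometry.Shioda1983.FermatThreefold
import HarnessLib

/-!
# Fermat cycles — Shioda's condition `(R³ₘ)` beyond print, the residual lists at `11 ≤ m ≤ 17`, and the cell's residual `γ₅₅`

HONEST FRAMING: explicit algebraic cycles for specific Hodge classes on Fermat/Delsarte varieties;
residual open instances listed; no claim on general Hodge.

Topic path `Summits/HodgeConjecture/FermatCycles/` of cell `pub-hfermat` (new work, not literature). Companion to
`Literature/AlgebraicGeometry/Shioda1983/FermatThreefold.lean`, which types Shioda's set `I` (`IsLevelOne`), "decomposable"
(`IsDecomposable`), "quasi-decomposable" (`IsQuasiDecomposable`), the condition `(R³ₘ)` (`ConditionR`), residual lists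
(`ResidualWithin`), the kernel search `checkP` with its soundness theorem `forall_of_chunks`, and the printed data points
(`(R³ₘ)` for `m ≤ 10`, `¬ (R³₁₁)`). Shioda 1983 (13): `(R³ₘ)` implies Hodge(X³ₘ, F'¹H³) — every rational class of Hodge level one in
`H³` of the Fermat threefold `X³ₘ` is supported on a divisor (Grothendieck's generalised form of Hodge's problem, coniveau `1`);
in print this is known exactly for `m ≤ 10` [Shioda1983WhatIsKnown, (13) p. 64; Ran1980, Thm 3.16 / Ex. 3.17]. That implication is
QUOTED here, never asserted: this file is arithmetic only.

WHAT IS PROVED (kernel; the cell's two independent enumerations `code/lit/r3/r3census.py`, `r3census_impl2.py` agree with every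
statement below and with each other at all `3 ≤ m ≤ 64`):
* `conditionR_twelve`, `conditionR_eighteen`, `conditionR_twenty` — **`(R³ₘ)` holds for `m = 12, 18, 20`**: three levels beyond
  Shioda's printed range `m ≤ 10` at which his own criterion applies (by the census these are the ONLY such levels in
  `11 ≤ m ≤ 64`; that negative statement is not formalised). With (13): Hodge(X³ₘ, F'¹H³) for `m = 12, 18, 20` by the printed method.
* `residual_eleven`, …, `residual_seventeen` — at `m = 11, 13, 14, 15, 16, 17` the COMPLETE list of elements of `I` that are neither
  decomposable nor quasi-decomposable, up to units (`ResidualWithin m reps`: every element of `I` is decomposable,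
  quasi-decomposable, or a unit multiple of a listed representative), and for each listed representative that it is indeed in `I`
  and neither decomposable nor quasi-decomposable (`residualReps_eleven_spec`, …). At `m = 11` the list is Shioda's `(1 1 5 7 8)`
  together with `(1 3 4 5 9)` = the squares mod `11`. These lists are the arithmetic input ("which characters are left") of any
  argument for Hodge(X³ₘ, F'¹H³) at these levels that goes beyond (13); the cell's probe (`code/lit/r3/probe_ghc3.py`, ONE
  implementation, 2026-08-20) finds for every listed representative either a pencil of the cell's Prop C shape or a uniruled
  quotient `X³ₘ/Ker a` (empty Fine interior, independently checked certificate) — recorded in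
  `run/shared/lean/pub/pub-hfermat/lit/GHC-FERMAT-THREEFOLD-IN-PRINT.md` §D3 as CANDIDATES for the search/referee seats, not used here.
* `gamma55_spec` — the cell's last residual class: `γ₅₅ = (1, 16, 26, 31, 36) = ⟨16⟩ ⊂ (ℤ/55)ˣ` (search-2 `TRANSFER.md` §5:
  `ξ₅₅ = γ₅₅ ∗ 3γ₅₅`, and `ξ₅₅` is algebraic as soon as `N(γ₅₅) ⊂ N¹H³(X³₅₅)`) lies in `I₅₅` and is NEITHER decomposable NOR
  quasi-decomposable: the printed criterion (13) / Ran's (1.10)₅₅ does not reach it (`not_conditionR_fiftyFive`). The two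
  representatives left at `m = 22` by print and probe alike, `(1,1,12,14,16)` and `(1,3,12,14,14)`, are recorded the same way
  (`wall_twentyTwo_spec`).

References: [Shioda1983WhatIsKnown] T. Shioda, Adv. Stud. Pure Math. 1 (1983) 55–68, (13) pp. 63–64; [Ran1980] Z. Ran, Compositio
Math. 42 (1980/81) 121–142, (1.10), Thm 3.16; cell files `lit/GHC-FERMAT-THREEFOLD-IN-PRINT.md`, `code/lit/r3/`,
`pub-hfermat-search-2/TRANSFER.md` §5.
-/

namespace Summit.HodgeConjecture.FermatCycles.ThreefoldConditionR

open Multiset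
open Literature.AlgebraicGeometry.Shioda1982 Literature.AlgebraicGeometry.Shioda1983

/-- One chunk `[1, N)` covers every first representative. [folklore] -/
theorem cover_one (N : ℕ) : ∀ a, 0 < a → a < N → ∃ p ∈ [(1, N - 1)], p.1 ≤ a ∧ a < p.1 + p.2 :=
  fun a h0 h1 ↦ ⟨(1, N - 1), List.mem_singleton.mpr rfl, h0, by dsimp only; omega⟩

/-! ### `(R³ₘ)` at `m = 12, 18, 20` (beyond the printed `m ≤ 10`) -/

set_option maxHeartbeats 0 in
/-- **`(R³₁₂)` holds**: every element of `I₁₂` is decomposable or quasi-decomposable (census: `|I₁₂| = 198` sorted multisets,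
`144` decomposable, `54` quasi-decomposable only). Kernel exhaustion. With Shioda 1983 (13) (quoted): Hodge(X³₁₂, F'¹H³).
[cite: Shioda1983WhatIsKnown, (13) p. 64 (criterion; printed range m ≤ 10)] -/
theorem conditionR_twelve : ConditionR 12 :=
  conditionR_of_chunks 12 _ (cover_one 12) (by intro p hp; rw [List.mem_singleton] at hp; subst hp; decide +kernel)

set_option maxHeartbeats 0 in
/-- The search at `18`, first representatives `a ∈ [1, 4)`. Kernel. [folklore] -/
theorem checkP_18_1 : checkP 18 (fun s ↦ IsDecomposable s ∨ IsQuasiDecomposable s) 1 3 = true := by decide +kernel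

set_option maxHeartbeats 0 in
/-- The search at `18`, first representatives `a ∈ [4, 18)`. Kernel. [folklore] -/
theorem checkP_18_4 : checkP 18 (fun s ↦ IsDecomposable s ∨ IsQuasiDecomposable s) 4 14 = true := by decide +kernel

/-- **`(R³₁₈)` holds** (census: `|I₁₈| = 820`, `486` decomposable, `334` quasi-decomposable only). Kernel exhaustion, two chunks.
With (13): Hodge(X³₁₈, F'¹H³). [cite: Shioda1983WhatIsKnown, (13) p. 64 (criterion)] -/
theorem conditionR_eighteen : ConditionR 18 :=
  conditionR_of_chunks 18 [(1, 3), (4, 14)] (by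
    intro a h0 h1
    rcases Nat.lt_or_ge a 4 with h | h
    · exact ⟨(1, 3), by simp, by omega, by omega⟩
    · exact ⟨(4, 14), by simp, h, by omega⟩) (by
    intro p hp
    simp only [List.mem_cons, List.not_mem_nil, or_false] at hp
    rcases hp with rfl | rfl
    · exact checkP_18_1
    · exact checkP_18_4)

set_option maxHeartbeats 0 in
/-- The search at `20`, first representatives `a ∈ [1, 4)`. Kernel. [folklore] -/
theorem checkP_20_1 : checkP 20 (fun s ↦ IsDecomposable s ∨ IsQuasiDecomposable s) 1 3 = true := by decide +kernel

set_option maxHeartbeats 0 in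
/-- The search at `20`, first representatives `a ∈ [4, 20)`. Kernel. [folklore] -/
theorem checkP_20_4 : checkP 20 (fun s ↦ IsDecomposable s ∨ IsQuasiDecomposable s) 4 16 = true := by decide +kernel

/-- **`(R³₂₀)` holds** (census: `|I₂₀| = 1152`, `660` decomposable, `492` quasi-decomposable only). Kernel exhaustion, two chunks.
With (13): Hodge(X³₂₀, F'¹H³). [cite: Shioda1983WhatIsKnown, (13) p. 64 (criterion)] -/
theorem conditionR_twenty : ConditionR 20 :=
  conditionR_of_chunks 20 [(1, 3), (4, 16)] (by
    intro a h0 h1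
    rcases Nat.lt_or_ge a 4 with h | h
    · exact ⟨(1, 3), by simp, by omega, by omega⟩
    · exact ⟨(4, 16), by simp, h, by omega⟩) (by
    intro p hp
    simp only [List.mem_cons, List.not_mem_nil, or_false] at hp
    rcases hp with rfl | rfl
    · exact checkP_20_1
    · exact checkP_20_4)

/-! ### The complete residual lists at `m = 11, 13, 14, 15, 16, 17` -/

/-- Residual representatives at `m = 11`: Shioda's `(1 1 5 7 8)` and `(1 3 4 5 9)` (the squares mod `11`). -/
def residualReps_eleven : List (Multiset (ZMod 11)) := [{1, 1, 5, 7, 8}, {1, 3, 4, 5, 9}]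

/-- Residual representatives at `m = 13`. -/
def residualReps_thirteen : List (Multiset (ZMod 13)) := [{1, 1, 6, 8, 10}, {1, 2, 6, 8, 9}]

/-- Residual representative at `m = 14`. -/
def residualReps_fourteen : List (Multiset (ZMod 14)) := [{1, 3, 8, 8, 8}]

/-- Residual representative at `m = 15`. -/
def residualReps_fifteen : List (Multiset (ZMod 15)) := [{1, 4, 5, 7, 13}]

/-- Residual representatives at `m = 16`. -/
def residualReps_sixteen : List (Multiset (ZMod 16)) := [{1, 4, 5, 9, 13}, {1, 5, 6, 6, 14}]

/-- Residual representatives at `m = 17`. -/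
def residualReps_seventeen : List (Multiset (ZMod 17)) :=
  [{1, 1, 8, 10, 14}, {1, 1, 8, 11, 13}, {1, 2, 7, 11, 13}, {1, 2, 8, 10, 13}, {1, 2, 8, 11, 12}, {1, 3, 4, 11, 15}]

set_option maxHeartbeats 0 in
/-- **Residual list at `m = 11` is complete**: every element of `I₁₁` contains a pair `{a, −a}`, or is a unit multiple of
`(1,1,5,7,8)` or of `(1,3,4,5,9)` (no element of `I₁₁` is quasi-decomposable without being decomposable: `𝔅²₁₁` consists of
pairs of pairs). Kernel exhaustion. [cite: Shioda1983WhatIsKnown, (13) p. 64 (the example (1 1 5 7 8) at m = 11)] -/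
theorem residual_eleven : ResidualWithin 11 residualReps_eleven :=
  residualWithin_of_chunks 11 _ _ (cover_one 11) (by intro p hp; rw [List.mem_singleton] at hp; subst hp; decide +kernel)

/-- Both representatives at `m = 11` lie in `I₁₁` and are neither decomposable nor quasi-decomposable. Kernel. -/
theorem residualReps_eleven_spec : ∀ r ∈ residualReps_eleven, IsLevelOne r ∧ ¬ IsDecomposable r ∧ ¬ IsQuasiDecomposable r := by
  decide +kernel

set_option maxHeartbeats 0 in
/-- **Residual list at `m = 13` is complete** (two unit orbits). Kernel exhaustion. -/
theorem residual_thirteen : ResidualWithin 13 residualReps_thirteen :=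
  residualWithin_of_chunks 13 _ _ (cover_one 13) (by intro p hp; rw [List.mem_singleton] at hp; subst hp; decide +kernel)

/-- The representatives at `m = 13` lie in `I₁₃` and are neither decomposable nor quasi-decomposable. Kernel. -/
theorem residualReps_thirteen_spec :
    ∀ r ∈ residualReps_thirteen, IsLevelOne r ∧ ¬ IsDecomposable r ∧ ¬ IsQuasiDecomposable r := by
  decide +kernel

set_option maxHeartbeats 0 in
/-- **Residual list at `m = 14` is complete** (one unit orbit). Kernel exhaustion. -/
theorem residual_fourteen : ResidualWithin 14 residualReps_fourteen :=
  residualWithin_of_chunks 14 _ _ (cover_one 14) (by intro p hp; rw [List.mem_singleton] at hp; subst hp; decide +kernel)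

/-- The representative at `m = 14` lies in `I₁₄` and is neither decomposable nor quasi-decomposable. Kernel. -/
theorem residualReps_fourteen_spec :
    ∀ r ∈ residualReps_fourteen, IsLevelOne r ∧ ¬ IsDecomposable r ∧ ¬ IsQuasiDecomposable r := by
  decide +kernel

set_option maxHeartbeats 0 in
/-- **Residual list at `m = 15` is complete** (one unit orbit). Kernel exhaustion. -/
theorem residual_fifteen : ResidualWithin 15 residualReps_fifteen :=
  residualWithin_of_chunks 15 _ _ (cover_one 15) (by intro p hp; rw [List.mem_singleton] at hp; subst hp; decide +kernel)

/-- The representative at `m = 15` lies in `I₁₅` and is neither decomposable nor quasi-decomposable. Kernel. -/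
theorem residualReps_fifteen_spec :
    ∀ r ∈ residualReps_fifteen, IsLevelOne r ∧ ¬ IsDecomposable r ∧ ¬ IsQuasiDecomposable r := by
  decide +kernel

set_option maxHeartbeats 0 in
/-- **Residual list at `m = 16` is complete** (two unit orbits). Kernel exhaustion. -/
theorem residual_sixteen : ResidualWithin 16 residualReps_sixteen :=
  residualWithin_of_chunks 16 _ _ (cover_one 16) (by intro p hp; rw [List.mem_singleton] at hp; subst hp; decide +kernel)

/-- The representatives at `m = 16` lie in `I₁₆` and are neither decomposable nor quasi-decomposable. Kernel. -/
theorem residualReps_sixteen_spec :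
    ∀ r ∈ residualReps_sixteen, IsLevelOne r ∧ ¬ IsDecomposable r ∧ ¬ IsQuasiDecomposable r := by
  decide +kernel

set_option maxHeartbeats 0 in
/-- **Residual list at `m = 17` is complete** (six unit orbits). Kernel exhaustion. -/
theorem residual_seventeen : ResidualWithin 17 residualReps_seventeen :=
  residualWithin_of_chunks 17 _ _ (cover_one 17) (by intro p hp; rw [List.mem_singleton] at hp; subst hp; decide +kernel)

/-- The representatives at `m = 17` lie in `I₁₇` and are neither decomposable nor quasi-decomposable. Kernel. -/
theorem residualReps_seventeen_spec :
    ∀ r ∈ residualReps_seventeen, IsLevelOne r ∧ ¬ IsDecomposable r ∧ ¬ IsQuasiDecomposable r := by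
  decide +kernel

/-! ### The cell's residual character `γ₅₅` and the first wall `m = 22` -/

/-- `γ₅₅ = (1, 16, 26, 31, 36)` — the subgroup `⟨16⟩ ≤ (ℤ/55)ˣ` of order `5`, as a character of `X³₅₅` (search-2 TRANSFER §5). -/
def gamma55 : Multiset (ZMod 55) := {1, 16, 26, 31, 36}

set_option maxHeartbeats 0 in
/-- **`γ₅₅` is in `I₅₅` and is neither decomposable nor quasi-decomposable**: the printed criterion (Shioda 1983 (13) = Ran's
Statement (1.10)₅₅) does not reach the cell's last residual instance `N(γ₅₅) ⊂ N¹H³(X³₅₅)`. Kernel.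
[cite: Shioda1983WhatIsKnown, (13) p. 63–64] [cite: Ran1980, Statement (1.10) p. 126] -/
theorem gamma55_spec : IsLevelOne gamma55 ∧ ¬ IsDecomposable gamma55 ∧ ¬ IsQuasiDecomposable gamma55 := by
  refine ⟨?_, ?_, ?_⟩
  all_goals decide +kernel

/-- Hence `(R³₅₅)` fails (so does Ran's (1.10)₅₅). [cite: Shioda1983WhatIsKnown, (13) p. 64] -/
theorem not_conditionR_fiftyFive : ¬ ConditionR 55 := by
  intro h
  obtain ⟨h1, h2, h3⟩ := gamma55_spec
  rcases h _ h1 with h | h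
  · exact h2 h
  · exact h3 h

/-- The two representatives at `m = 22` that neither print nor the cell's probe certifies (p_g of the quotient is positive, no pencil):
`(1,1,12,14,16)` and `(1,3,12,14,14)`. -/
def wallReps_twentyTwo : List (Multiset (ZMod 22)) := [{1, 1, 12, 14, 16}, {1, 3, 12, 14, 14}]

set_option maxHeartbeats 0 in
/-- Both `m = 22` representatives lie in `I₂₂` and are neither decomposable nor quasi-decomposable. Kernel. -/
theorem wall_twentyTwo_spec :
    ∀ r ∈ wallReps_twentyTwo, IsLevelOne r ∧ ¬ IsDecomposable r ∧ ¬ IsQuasiDecomposable r := by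
  decide +kernel

end Summit.HodgeConjecture.FermatCycles.ThreefoldConditionR
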